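import Literature.MathematicalPhysics.QuantumLattice.InequivalentLayerStackingTransport
import Literature.MathematicalPhysics.QuantumLattice.DWaveSourceEnergyDensityEnsembles
import HarnessLib

/-!
# Trilayer `t–t'` Hubbard crystals with INEQUIVALENT inner and outer planes (Hg-1223 class): 2D rows per plane
# ⇒ crystal words, plane-by-plane near ground states and word transfer, inner/outer doping-split brackets

Topic `Literature/MathematicalPhysics/QuantumLattice` (namespace = path; family `hubbard`). The `d = 2`, period-3
instance of `InequivalentLayerStackingTransport` in the vocabulary of the tree's certified `t–t'` objects
(`energyDensityTT'`, the grand potential `gcEnergyDensityTT'`, `μ`-floors). The record-`T_c` cuprate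
HgBa₂Ca₂Cu₃O₈ is a TRILAYER crystal whose inner plane (no apical oxygen) and two outer planes carry different
one-band parameters and different hole densities (Mukuda–Shimizu–Iyo–Kitaoka 2012 §2, layer-resolved NMR; the
tree's `HalfBathtubPairTableRowsHg1223*` already certify 2D rows PER PLANE with distinct `t'/t` intervals).

THE CRYSTAL (`trilayerHubbardTTPrimeViews t t' U ε tperp tperp'`): layer classes `j ∈ Fin 3` (`0, 2` = outer
planes, `1` = inner plane, or any assignment), plane `j` = the `t_j–t'_j–U_j` Hubbard model with site energy
`ε_j`; vertical bonds `(1,0,0)`: from class `0` and class `1` with amplitude `t⊥` (the two intra-trilayer bonds),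
from class `2` with `t⊥'` (inter-trilayer, across the spacer); ALLOWANCE `A = (2/3)(2|t⊥| + |t⊥'|)`.

## Contents (all PROVED)

* §1 `trilayerTz`, `trilayerHubbardTTPrimeViews`, bookkeeping (`sum_abs_trilayerTz`, `trilayer_allowance`,
  `vectorHoppingModel_ttPrime`, `pencil_ttPrime_eq_hubbardTTPrimeMu`, …).
* §2 **`trilayer_gcFloors_le_infCellEnergyOn`** — THE FLOOR FROM THE CERTIFIED TABLE: `μ`-floors `(c_j, μ − ε_j)` of
  the three planes (`c_j + (μ−ε_j) m ≤ energyDensityTT' t_j t'_j U_j m` on `[0,2)`, the vocabulary of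
  `HubbardTTPrimeChemicalPotentialFloors`) at ONE common `μ` give `(1/3)Σ_j c_j + μ ρ̄ − A ≤ inf_{periodic, filling ρ̄} e`
  (boundary densities `0, 2` of a plane are covered through `gcEnergyDensityTT'_le_meanEnergy_hubbardTTPrimeMu`);
  **`trilayer_infCellEnergyOn_le_split`** — the cap `(1/3)Σ_j [energyDensityTT' t_j t'_j U_j ρ_j + ε_j ρ_j]` at every
  interior split of `ρ̄`.
* §3 **`trilayer_meanEnergy_layerMarginal_le`**: every plane marginal `σ_j` (interior filling `n_j`) of a periodic
  state within `δ` of the infimum at its own cell filling obeys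
  `e_{Φ(t_j,t'_j,U_j)}(σ_j) ≤ energyDensityTT' t_j t'_j U_j n_j + 3δ + 2(2|t⊥| + |t⊥'|)`;
  **`trilayer_of_energyWindow_word_layerMarginal`**: a 2D energy-window word for plane `j`'s own `(t_j, t'_j, U_j)` on
  a filling range `[nlo, nhi] ⊂ (0,2)` with slack `ε' ≥ 3δ + 2(2|t⊥| + |t⊥'|)` holds for `σ_j` — the inner and the
  outer planes receive THEIR OWN words.
* §4 **`trilayer_layerDensity_brackets`** (grand-canonical near ground states at `μ`) and
  **`trilayer_layerDensity_brackets_canonical`** (near ground states at their own cell filling, any trial `μ` with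
  slack `B`): with `ν_j = μ − ε_j`, `Δ = 3δ + 2(2|t⊥|+|t⊥'|)` (resp. `3(δ+B) + …`) and `p_j = gcEnergyDensityTT' t_j t'_j U_j`,
  `(p_j(ν_j − h) − p_j(ν_j) − Δ)/h ≤ n_j ≤ (p_j(ν_j) − p_j(ν_j + h) + Δ)/h` — the INNER/OUTER DOPING SPLIT of the
  crystal from certified two-sided bounds on the planes' 2D grand potentials at three chemical potentials each.

No named fact, no number of record, no `sorry`; definitions with bodies: `trilayerTz`, `trilayerHubbardTTPrimeViews`.
HONEST SCOPE: `U_j ≥ 0`; energies and densities only, `T = 0`; the site energies `ε_j` (Madelung offsets) and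
`t⊥, t⊥'` are inputs (downfold rows), not derived; the canonical slack `B(μ)` must be bounded by the consumer
(any split cap minus `μρ̄` minus certified grand-potential floors); nothing here is a phase word.

## Tree search

REUSED: everything of `InequivalentLayerStackingTransport` / `LayerMarginalsAndPlaneStacks`; `ttPrimeVec(_ne_zero/
_mem_thicken_one)`, `ttPrimeAmp`, `hubbardTTPrimeFermionInteraction_eq_vectorHoppingModel`, `unitVec_zero_apply_zero_ne_zero`
(`LayeredLatticeEnergyTransport`); `unitVec_mem_thicken_one`; `tiGroundEnergyDensityAt_hubbardTTPrime_eq_energyDensityTT'`,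
`exists_isTranslationInvariant_density_eq` (`TIGroundEnergyDensityCouplingFamilies`); `hubbardTTPrimeMuInteraction`,
`tiGroundEnergyDensity_hubbardTTPrimeMu_eq_gcEnergyDensityTT'` (`DWaveSourceEnergyDensityEnsembles`), `le_gcEnergyDensityTT'`
(`HubbardTTPrimeGrandCanonicalEnergyDensity`). `lean search 'trilayer' --decl`: only the equal-plane remarks of
`PeriodicLayeredLatticeEnergyTransport`; per-plane Hg-1223 rows: `HalfBathtubPairTableRowsHg1223*`.

## References

* H. Mukuda, S. Shimizu, A. Iyo, Y. Kitaoka, J. Phys. Soc. Jpn. 81 (2012) 011008, §2. [cite: MukudaEtAl2012, §2]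
* E. Pavarini et al., PRL 87 (2001) 047003, eq. (1). [cite: PavariniEtAl2001, eq. (1)]
* R. T. Rockafellar, *Convex Analysis* (1970), Thm. 16.4. [cite: Rockafellar1970, Thm 16.4]
* D. Ruelle, *Statistical Mechanics: Rigorous Results* (1969), §3.4. [cite: Ruelle1969, §3.4]
* O. Bratteli, A. Kishimoto, D. W. Robinson, CMP 64 (1978) 41, Thm. 2. [cite: BratteliKishimotoRobinson1978, Thm. 2 (condition 2)]
* Koma–Tasaki (1994) §1 (tangent brackets). [cite: KomaTasaki1994, §1]
-/

noncomputable section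

namespace Literature.MathematicalPhysics.QuantumLattice

open Matrix Finset HubbardWave0 Literature.Probability.LatticeModels ThermodynamicLimit
open scoped ComplexOrder BigOperators

/-! ### §1. The trilayer crystal -/

section Trilayer

/-- **Interlayer amplitudes of a trilayer stacking**: the vertical bond starting in a layer of class `0` or `1`
carries `t⊥` (intra-trilayer), the one starting in class `2` carries `t⊥'` (inter-trilayer). [cite: MukudaEtAl2012, §2] -/
def trilayerTz (tperp tperp' : ℝ) : Fin 3 → Fin 1 → ℝ := fun j _ => ![tperp, tperp, tperp'] j

/-- **The trilayer `t–t'` Hubbard crystal with inequivalent planes**: plane `j` = `Φ(t_j, t'_j, U_j)` with site energy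
`ε_j`, vertical interlayer bonds with the trilayer amplitudes. [cite: MukudaEtAl2012, §2] -/
def trilayerHubbardTTPrimeViews (t t' U ε : Fin 3 → ℝ) (tperp tperp' : ℝ) :
    Cell (stackPeriods 2 2) → FermionInteraction 3 :=
  planeResolvedViews 2 ε U ttPrimeVec (fun j => ttPrimeAmp (t j) (t' j)) (fun _ : Fin 1 => (unitVec (0 : Fin 3) : Site 3))
    (trilayerTz tperp tperp')

/-- The interlayer amplitudes of the trilayer sum to `2|t⊥| + |t⊥'|`. [cite: MukudaEtAl2012, §2] -/
theorem sum_abs_trilayerTz (tperp tperp' : ℝ) :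
    ∑ jb : Fin (2 + 1) × Fin 1, |trilayerTz tperp tperp' jb.1 jb.2| = 2 * |tperp| + |tperp'| := by
  rw [Fintype.sum_prod_type]
  simp [trilayerTz, Fin.sum_univ_succ]
  ring

/-- **The trilayer allowance is `(2/3)(2|t⊥| + |t⊥'|)`.** [cite: BratteliRobinsonI1987, Prop. 2.3.11] -/
theorem trilayer_allowance (tperp tperp' : ℝ) :
    2 / (((2 : ℕ) : ℝ) + 1) * ∑ jb : Fin (2 + 1) × Fin 1, |trilayerTz tperp tperp' jb.1 jb.2| =
      2 / 3 * (2 * |tperp| + |tperp'|) := by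
  rw [sum_abs_trilayerTz]
  norm_num

/-- Twice the interlayer sum. [cite: BratteliRobinsonI1987, Prop. 2.3.11] -/
theorem two_mul_sum_abs_trilayerTz (tperp tperp' : ℝ) :
    2 * ∑ jb : Fin (2 + 1) × Fin 1, |trilayerTz tperp tperp' jb.1 jb.2| = 2 * (2 * |tperp| + |tperp'|) := by
  rw [sum_abs_trilayerTz]

/-- The trilayer cell has three classes. [cite: ArakiMoriya2003, §4.1] -/
theorem trilayer_card : (((2 : ℕ) : ℝ) + 1) = 3 := by norm_num

/-- The one-band model with the `t–t'` vectors is the `t–t'` Hubbard interaction. [cite: PavariniEtAl2001, eq. (1)] -/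
theorem vectorHoppingModel_ttPrime (t t' U : ℝ) :
    vectorHoppingModel U ttPrimeVec (ttPrimeAmp t t') = hubbardTTPrimeFermionInteraction t t' U :=
  (hubbardTTPrimeFermionInteraction_eq_vectorHoppingModel t t' U).symm

/-- The `μ`-pencil of a plane is the tree's `hubbardTTPrimeMuInteraction` at chemical potential `−s`. [cite: Ruelle1969, §3.4] -/
theorem pencil_ttPrime_eq_hubbardTTPrimeMu (t t' U s : ℝ) :
    FermionInteraction.pencil (vectorHoppingModel U ttPrimeVec (ttPrimeAmp t t')) (numberInteraction 2) s =
      hubbardTTPrimeMuInteraction t t' U (-s) := by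
  rw [vectorHoppingModel_ttPrime, hubbardTTPrimeMuInteraction, neg_neg]

/-- The vertical unit vector is non-zero. [cite: ArakiMoriya2003, §4.1] -/
theorem unitVec_zero_ne_zero₃ : (unitVec (0 : Fin 3) : Site 3) ≠ 0 := fun h0 =>
  unitVec_zero_apply_zero_ne_zero (by rw [h0]; rfl)

/-! ### §2. Crystal words from the planes' certified 2D objects -/

/-- **FLOOR FROM THE PLANES' `μ`-FLOORS** (`U_j ≥ 0`): if `c_j + (μ − ε_j)·m ≤ energyDensityTT' t_j t'_j U_j m` for all
`0 ≤ m < 2` (a certified `μ`-floor of plane `j` at the SHIFTED chemical potential `μ − ε_j`), then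
`(1/3) Σ_j c_j + μ ρ̄ − (2/3)(2|t⊥| + |t⊥'|) ≤ inf_{periodic, cell filling ρ̄} e(trilayer crystal)`. [cite: Rockafellar1970, Thm 16.4] -/
theorem trilayer_gcFloors_le_infCellEnergyOn (t t' ε : Fin 3 → ℝ) {U : Fin 3 → ℝ} (hU : ∀ j, 0 ≤ U j)
    (tperp tperp' : ℝ) {ρbar : ℝ} (hS : (periodicStatesAt (stackPeriods 2 2) ρbar).Nonempty) (μ : ℝ) (c : Fin 3 → ℝ)
    (hc : ∀ (j : Fin 3) (m : ℝ), 0 ≤ m → m < 2 → c j + (μ - ε j) * m ≤ energyDensityTT' (t j) (t' j) (U j) m) :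
    3⁻¹ * ∑ j, c j + μ * ρbar - 2 / 3 * (2 * |tperp| + |tperp'|) ≤
      infCellEnergyOn (periodicStatesAt (stackPeriods 2 2) ρbar) (trilayerHubbardTTPrimeViews t t' U ε tperp tperp') 1 := by
  have hc' : ∀ j : Fin 3, c j ≤ (FermionInteraction.pencil (vectorHoppingModel (U j) ttPrimeVec (ttPrimeAmp (t j) (t' j)))
      (numberInteraction 2) (ε j - μ)).tiGroundEnergyDensity 1 := fun j => by
    rw [pencil_ttPrime_eq_hubbardTTPrimeMu, neg_sub, tiGroundEnergyDensity_hubbardTTPrimeMu_eq_gcEnergyDensityTT' _ _ (hU j)]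
    exact le_gcEnergyDensityTT' (hc j)
  have h := le_infCellEnergyOn_planeResolved_of_gcFloors 2 ε U ttPrimeVec_ne_zero (fun j => ttPrimeAmp (t j) (t' j))
    (w := fun _ : Fin 1 => (unitVec (0 : Fin 3) : Site 3)) (fun _ => unitVec_zero_ne_zero₃) (trilayerTz tperp tperp')
    le_rfl le_rfl ttPrimeVec_mem_thicken_one (fun _ => unitVec_mem_thicken_one 0) hS μ c hc'
  rw [trilayer_allowance, trilayer_card] at h
  exact h

/-- **CAP AT A DENSITY SPLIT** (`U_j ≥ 0`, interior `ρ_j`): `inf_{periodic, filling (1/3)Σρ_j} e ≤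
(1/3) Σ_j [energyDensityTT' t_j t'_j U_j ρ_j + ε_j ρ_j]` (consumers insert certified caps of the three planes).
[cite: Rockafellar1970, Thm 5.4] -/
theorem trilayer_infCellEnergyOn_le_split (t t' ε : Fin 3 → ℝ) {U : Fin 3 → ℝ} (hU : ∀ j, 0 ≤ U j)
    (tperp tperp' : ℝ) (ρ : Fin 3 → ℝ) (hρ0 : ∀ j, 0 < ρ j) (hρ2 : ∀ j, ρ j < 2) :
    infCellEnergyOn (periodicStatesAt (stackPeriods 2 2) (3⁻¹ * ∑ j, ρ j))
        (trilayerHubbardTTPrimeViews t t' U ε tperp tperp') 1 ≤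
      3⁻¹ * ∑ j, (energyDensityTT' (t j) (t' j) (U j) (ρ j) + ε j * ρ j) := by
  have h := infCellEnergyOn_planeResolved_le_split 2 two_pos ε U ttPrimeVec_ne_zero (fun j => ttPrimeAmp (t j) (t' j))
    (w := fun _ : Fin 1 => (unitVec (0 : Fin 3) : Site 3)) (fun _ => unitVec_zero_apply_zero_ne_zero)
    (trilayerTz tperp tperp') le_rfl le_rfl ttPrimeVec_mem_thicken_one (fun _ => unitVec_mem_thicken_one 0) ρ
    fun j => exists_isTranslationInvariant_density_eq (hρ0 j) (hρ2 j)
  simp only [vectorHoppingModel_ttPrime, tiGroundEnergyDensityAt_hubbardTTPrime_eq_energyDensityTT' _ _ (hU _) (hρ0 _)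
    (hρ2 _), trilayer_card] at h
  exact h

/-! ### §3. Plane by plane -/

/-- **EACH PLANE IS A NEAR GROUND STATE OF ITS OWN `t_j–t'_j–U_j` MODEL AT ITS OWN FILLING**: for a periodic state
within `δ` of the infimum at its own cell filling and a plane marginal of interior filling `n_j`,
`e_{Φ(t_j,t'_j,U_j)}(σ_j) ≤ energyDensityTT' t_j t'_j U_j n_j + 3δ + 2(2|t⊥| + |t⊥'|)` (site energies cancel).
[cite: BratteliKishimotoRobinson1978, Thm. 2 (condition 2)] -/
theorem trilayer_meanEnergy_layerMarginal_le {ω : InfVolFermionState 3} (hω : ω.IsPeriodic (stackPeriods 2 2))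
    (t t' ε : Fin 3 → ℝ) {U : Fin 3 → ℝ} (hU : ∀ j, 0 ≤ U j) (tperp tperp' : ℝ) {δ : ℝ}
    (hδ : ω.cellEnergy (trilayerHubbardTTPrimeViews t t' U ε tperp tperp') 1 ≤
      infCellEnergyOn (periodicStatesAt (stackPeriods 2 2) (ω.cellFilling (stackPeriods 2 2)))
        (trilayerHubbardTTPrimeViews t t' U ε tperp tperp') 1 + δ)
    (j : Fin 3) (hn0 : 0 < (ω.layerMarginal (layerCoset 2 j)).density) (hn2 : (ω.layerMarginal (layerCoset 2 j)).density < 2) :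
    (ω.layerMarginal (layerCoset 2 j)).meanEnergy (hubbardTTPrimeFermionInteraction (t j) (t' j) (U j)) 1 ≤
      energyDensityTT' (t j) (t' j) (U j) (ω.layerMarginal (layerCoset 2 j)).density +
        (3 * δ + 2 * (2 * |tperp| + |tperp'|)) := by
  have h := hω.meanEnergy_layerMarginal_le 2 two_pos ε U ttPrimeVec_ne_zero (fun j => ttPrimeAmp (t j) (t' j))
    (w := fun _ : Fin 1 => (unitVec (0 : Fin 3) : Site 3)) (fun _ => unitVec_zero_apply_zero_ne_zero)
    (trilayerTz tperp tperp') le_rfl le_rfl ttPrimeVec_mem_thicken_one (fun _ => unitVec_mem_thicken_one 0) hδ j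
  rw [vectorHoppingModel_ttPrime, tiGroundEnergyDensityAt_hubbardTTPrime_eq_energyDensityTT' _ _ (hU j) hn0 hn2,
    two_mul_sum_abs_trilayerTz, trilayer_card] at h
  exact h

/-- **WORD TRANSFER TO THE INNER / OUTER PLANES**: a 2D energy-window word for plane `j`'s own parameters on a
filling range `[nlo, nhi] ⊂ (0, 2)` with slack `ε' ≥ 3δ + 2(2|t⊥| + |t⊥'|)` holds for the plane-`j` marginal of every
periodic near ground state whose plane-`j` filling lies in the range. [cite: BratteliKishimotoRobinson1978, Thm. 2 (condition 2)] -/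
theorem trilayer_of_energyWindow_word_layerMarginal {P : InfVolFermionState 2 → Prop} {ω : InfVolFermionState 3}
    (hω : ω.IsPeriodic (stackPeriods 2 2)) (t t' ε : Fin 3 → ℝ) {U : Fin 3 → ℝ} (hU : ∀ j, 0 ≤ U j)
    (tperp tperp' : ℝ) {δ : ℝ}
    (hδ : ω.cellEnergy (trilayerHubbardTTPrimeViews t t' U ε tperp tperp') 1 ≤
      infCellEnergyOn (periodicStatesAt (stackPeriods 2 2) (ω.cellFilling (stackPeriods 2 2)))
        (trilayerHubbardTTPrimeViews t t' U ε tperp tperp') 1 + δ)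
    (j : Fin 3) {nlo nhi ε' : ℝ} (hnlo : 0 < nlo) (hnhi : nhi < 2)
    (hword : ∀ σ : InfVolFermionState 2, σ.IsTranslationInvariant → nlo ≤ σ.density → σ.density ≤ nhi →
      σ.meanEnergy (hubbardTTPrimeFermionInteraction (t j) (t' j) (U j)) 1 ≤
        energyDensityTT' (t j) (t' j) (U j) σ.density + ε' → P σ)
    (hlo : nlo ≤ (ω.layerMarginal (layerCoset 2 j)).density) (hhi : (ω.layerMarginal (layerCoset 2 j)).density ≤ nhi)
    (hε' : 3 * δ + 2 * (2 * |tperp| + |tperp'|) ≤ ε') : P (ω.layerMarginal (layerCoset 2 j)) :=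
  hword _ (hω.isTranslationInvariant_layerMarginal _) hlo hhi
    ((trilayer_meanEnergy_layerMarginal_le hω t t' ε hU tperp tperp' hδ j (by linarith) (by linarith)).trans
      (by linarith))

/-! ### §4. Inner / outer doping-split brackets -/

/-- **INNER/OUTER DOPING BRACKETS, grand-canonical** (`U_j ≥ 0`): for a periodic state within `δ` of the infimum of the
`μ`-shifted crystal over all periodic states, with `ν_j = μ − ε_j`, `Δ = 3δ + 2(2|t⊥| + |t⊥'|)`, `p_j = gcEnergyDensityTT' t_j t'_j U_j`
and every `h > 0`: `(p_j(ν_j − h) − p_j(ν_j) − Δ)/h ≤ n_j ≤ (p_j(ν_j) − p_j(ν_j + h) + Δ)/h`. [cite: KomaTasaki1994, §1] -/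
theorem trilayer_layerDensity_brackets {ω : InfVolFermionState 3} (hω : ω.IsPeriodic (stackPeriods 2 2))
    (t t' ε : Fin 3 → ℝ) {U : Fin 3 → ℝ} (hU : ∀ j, 0 ≤ U j) (tperp tperp' μ : ℝ) {δ : ℝ}
    (hδ : ω.cellEnergy (trilayerHubbardTTPrimeViews t t' U (fun j => ε j - μ) tperp tperp') 1 ≤
      infCellEnergyOn (periodicStates (stackPeriods 2 2))
        (trilayerHubbardTTPrimeViews t t' U (fun j => ε j - μ) tperp tperp') 1 + δ)
    (j : Fin 3) {h : ℝ} (hh : 0 < h) :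
    (gcEnergyDensityTT' (t j) (t' j) (U j) (μ - ε j - h) - gcEnergyDensityTT' (t j) (t' j) (U j) (μ - ε j) -
        (3 * δ + 2 * (2 * |tperp| + |tperp'|))) / h ≤ (ω.layerMarginal (layerCoset 2 j)).density ∧
    (ω.layerMarginal (layerCoset 2 j)).density ≤
      (gcEnergyDensityTT' (t j) (t' j) (U j) (μ - ε j) - gcEnergyDensityTT' (t j) (t' j) (U j) (μ - ε j + h) +
        (3 * δ + 2 * (2 * |tperp| + |tperp'|))) / h := by
  have hb := hω.layerDensity_brackets 2 two_pos ε U ttPrimeVec_ne_zero (fun j => ttPrimeAmp (t j) (t' j))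
    (w := fun _ : Fin 1 => (unitVec (0 : Fin 3) : Site 3)) (fun _ => unitVec_zero_apply_zero_ne_zero)
    (trilayerTz tperp tperp') le_rfl le_rfl ttPrimeVec_mem_thicken_one (fun _ => unitVec_mem_thicken_one 0) μ hδ j hh
  simp only [pencil_ttPrime_eq_hubbardTTPrimeMu, tiGroundEnergyDensity_hubbardTTPrimeMu_eq_gcEnergyDensityTT' _ _ (hU _),
    two_mul_sum_abs_trilayerTz, trilayer_card] at hb
  have e1 : -(ε j - μ + h) = μ - ε j - h := by ring
  have e2 : -(ε j - μ) = μ - ε j := by ring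
  have e3 : -(ε j - μ - h) = μ - ε j + h := by ring
  rw [e1, e2, e3] at hb
  exact hb

/-- **INNER/OUTER DOPING BRACKETS, canonical** (`U_j ≥ 0`): for a periodic state within `δ` of the infimum at ITS OWN
cell filling `ρ̄`, any trial `μ` and any `B ≥ inf_{filling ρ̄} e − μρ̄ − (1/3)Σ_j p_j(μ − ε_j)`: the same brackets with
`Δ = 3(δ + B) + 2(2|t⊥| + |t⊥'|)`. [cite: KomaTasaki1994, §1] -/
theorem trilayer_layerDensity_brackets_canonical {ω : InfVolFermionState 3} (hω : ω.IsPeriodic (stackPeriods 2 2))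
    (t t' ε : Fin 3 → ℝ) {U : Fin 3 → ℝ} (hU : ∀ j, 0 ≤ U j) (tperp tperp' μ : ℝ) {δ B : ℝ}
    (hδ : ω.cellEnergy (trilayerHubbardTTPrimeViews t t' U ε tperp tperp') 1 ≤
      infCellEnergyOn (periodicStatesAt (stackPeriods 2 2) (ω.cellFilling (stackPeriods 2 2)))
        (trilayerHubbardTTPrimeViews t t' U ε tperp tperp') 1 + δ)
    (hB : infCellEnergyOn (periodicStatesAt (stackPeriods 2 2) (ω.cellFilling (stackPeriods 2 2)))
        (trilayerHubbardTTPrimeViews t t' U ε tperp tperp') 1 - μ * ω.cellFilling (stackPeriods 2 2) -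
        3⁻¹ * ∑ j, gcEnergyDensityTT' (t j) (t' j) (U j) (μ - ε j) ≤ B)
    (j : Fin 3) {h : ℝ} (hh : 0 < h) :
    (gcEnergyDensityTT' (t j) (t' j) (U j) (μ - ε j - h) - gcEnergyDensityTT' (t j) (t' j) (U j) (μ - ε j) -
        (3 * (δ + B) + 2 * (2 * |tperp| + |tperp'|))) / h ≤ (ω.layerMarginal (layerCoset 2 j)).density ∧
    (ω.layerMarginal (layerCoset 2 j)).density ≤
      (gcEnergyDensityTT' (t j) (t' j) (U j) (μ - ε j) - gcEnergyDensityTT' (t j) (t' j) (U j) (μ - ε j + h) +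
        (3 * (δ + B) + 2 * (2 * |tperp| + |tperp'|))) / h := by
  have hB' : infCellEnergyOn (periodicStatesAt (stackPeriods 2 2) (ω.cellFilling (stackPeriods 2 2)))
        (trilayerHubbardTTPrimeViews t t' U ε tperp tperp') 1 - μ * ω.cellFilling (stackPeriods 2 2) -
      (((2 : ℕ) : ℝ) + 1)⁻¹ * ∑ j, (FermionInteraction.pencil (vectorHoppingModel (U j) ttPrimeVec (ttPrimeAmp (t j) (t' j)))
        (numberInteraction 2) (ε j - μ)).tiGroundEnergyDensity 1 ≤ B := by
    simp only [pencil_ttPrime_eq_hubbardTTPrimeMu, tiGroundEnergyDensity_hubbardTTPrimeMu_eq_gcEnergyDensityTT' _ _ (hU _),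
      neg_sub, trilayer_card]
    exact hB
  have hb := hω.layerDensity_brackets_canonical 2 ε U ttPrimeVec_ne_zero (fun j => ttPrimeAmp (t j) (t' j))
    (w := fun _ : Fin 1 => (unitVec (0 : Fin 3) : Site 3)) (fun _ => unitVec_zero_ne_zero₃)
    (trilayerTz tperp tperp') le_rfl le_rfl ttPrimeVec_mem_thicken_one (fun _ => unitVec_mem_thicken_one 0) μ hδ hB' j hh
  simp only [pencil_ttPrime_eq_hubbardTTPrimeMu, tiGroundEnergyDensity_hubbardTTPrimeMu_eq_gcEnergyDensityTT' _ _ (hU _),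
    two_mul_sum_abs_trilayerTz, trilayer_card] at hb
  have e1 : -(ε j - μ + h) = μ - ε j - h := by ring
  have e2 : -(ε j - μ) = μ - ε j := by ring
  have e3 : -(ε j - μ - h) = μ - ε j + h := by ring
  rw [e1, e2, e3] at hb
  exact hb

end Trilayer

end Literature.MathematicalPhysics.QuantumLattice
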